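import Mathlib
import Summits.ValiantsHypothesis.ValiantsHypothesis.Theorems.DivisionGapPerMultiplesHardDensePerHardReg
import Literature.Combinatorics.Enumerative.VanDerWaerdenPermanent
import Literature.Combinatorics.Enumerative.VanDerWaerdenPermanentProofs
import Literature.Computability.AlgebraicComplexity.ArithCircuitProofs
import Literature.Computability.AlgebraicComplexity.PermanentIrreducible

/-!
# `DivisionGap.PerMultiplesHard` (stmt-ValiantsHypothesis-5068), line `uncharged-face-walk`:
stub `stub_blockCountOfFactor` — frozen extensions of a block with an `f`-factor are many

Fix a block `A × B` of the board `Fin n × Fin n` (`#A = #B = a`; cells `(row, column)`,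
permutations map columns to rows), a frozen matching `π₀` with `π₀ (B) = A`
(`j ∈ B ↔ π₀ j ∈ A`), a graph `Yb ⊆ A ×ˢ B` on the block and an `f`-regular subgraph
`Y' ⊆ Yb` (`f ≥ 1`; every row of `A` and every column of `B` has exactly `f` cells of `Y'`).
Let `P` be the set of permutations `π` FROZEN to `π₀` off the column block (`π j = π₀ j` for
`j ∉ B`) and inside `Yb` on the block (`(π j, j) ∈ Yb` for `j ∈ B`).  Then

  `f ^ a · a! ≤ a ^ a · #P`  (`stub_blockCountOfFactor`).

Proof.
1. SMALL BOARD.  Enumerate `A` and `B` by `eA : Fin a ≃ A`, `eB : Fin a ≃ B` and put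
   `Ys := {(x, y) : Fin a × Fin a | (eA x, eB y) ∈ Y'}`.  Its row and column degrees are `f`
   (`card_filter_univ_eq_card_filter`: the `Ys`-neighbours of `x` are in bijection with the
   `Y'`-neighbours of `eA x` in `B` through `eB`).
2. VAN DER WAERDEN on the small board: the counting consequence
   `DensePerHardReg.pow_mul_factorial_le_of_vdW` of the van der Waerden permanent bound
   (Egorychev–Falikman; discharged in the tree as
   `Literature.Combinatorics.Enumerative.VanDerWaerdenPermanent_holds`) gives
   `f ^ a · a! ≤ a ^ a · #PM(Ys)`, `PM(Ys)` the permutations of `Fin a` inside `Ys`.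
3. INJECTION `PM(Ys) ↪ P` (`exists_transport`): with `θ : B ≃ A` the restriction of `π₀`
   (`Equiv.subtypeEquiv`) and `τ := eA ⬝ θ⁻¹ ⬝ eB⁻¹ : Perm (Fin a)`, send `σ` to
   `Φ σ := π₀ * (σ ⬝ τ).extendDomain eB`.  Off `B` it is `π₀` (`extendDomain_apply_not_subtype`);
   on `B`, `Φ σ (eB y) = π₀ (θ⁻¹ (eA (σ y))) = eA (σ y)` (`extendDomain_apply_image`), so
   `(Φ σ (eB y), eB y) = (eA (σ y), eB y) ∈ Y' ⊆ Yb`, and `Φ` is injective (read `σ y` off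
   `Φ σ (eB y)`).  Conclude with `Finset.card_le_card_of_injOn`.
-/

noncomputable section

-- `Summit.ValiantsHypothesis.ValiantsHypothesis.…` is the tree's mandated layout (Sub = Summit).
set_option linter.dupNamespace false

namespace Summit.ValiantsHypothesis.ValiantsHypothesis.Theorems.DivisionGap.PerMultiplesHard.BlockCountOfFactor

open Finset Literature.Combinatorics.Enumerative
open scoped BigOperators

/-- **Transport of a degree along an enumeration.**  If `eB : Fin a ≃ B` enumerates `B ⊆ Fin n`
and `q y ↔ p (eB y)`, then `#{y : Fin a | q y} = #{j ∈ B | p j}`: `y ↦ eB y` is a bijection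
between the two sets (inverse `j ↦ eB⁻¹ ⟨j, _⟩`). [folklore] -/
theorem card_filter_univ_eq_card_filter {n a : ℕ} (B : Finset (Fin n))
    (eB : Fin a ≃ {x // x ∈ B}) (p : Fin n → Prop) [DecidablePred p] (q : Fin a → Prop)
    [DecidablePred q] (hpq : ∀ y, q y ↔ p (eB y)) :
    (univ.filter q).card = (B.filter p).card := by
  refine Finset.card_bij (fun y _ => ((eB y) : Fin n)) (fun y hy => ?_) (fun y₁ _ y₂ _ h => ?_)
    (fun j hj => ?_)
  · exact mem_filter.2 ⟨(eB y).2, (hpq y).1 (mem_filter.1 hy).2⟩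
  · exact eB.injective (Subtype.ext h)
  · obtain ⟨hjB, hpj⟩ := mem_filter.1 hj
    refine ⟨eB.symm ⟨j, hjB⟩, mem_filter.2 ⟨mem_univ _, (hpq _).2 ?_⟩, ?_⟩
    · simpa using hpj
    · simp

/-- **Transport of small-board permutations into the frozen block.**  Let `eA : Fin a ≃ A`,
`eB : Fin a ≃ B` enumerate `A, B ⊆ Fin n` and let `π₀` satisfy `π₀ (B) = A`
(`j ∈ B ↔ π₀ j ∈ A`).  Then there is a map `Φ : Perm (Fin a) → Perm (Fin n)` with
`Φ σ j = π₀ j` for `j ∉ B` and `Φ σ (eB y) = eA (σ y)`: namely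
`Φ σ = π₀ * (σ ⬝ τ).extendDomain eB` with `τ = eA ⬝ θ⁻¹ ⬝ eB⁻¹` and `θ : B ≃ A` the restriction
of `π₀` (`Equiv.subtypeEquiv`); off `B` the extension is the identity
(`Equiv.Perm.extendDomain_apply_not_subtype`), and on `B`
`Φ σ (eB y) = π₀ (θ⁻¹ (eA (σ y))) = eA (σ y)` (`Equiv.Perm.extendDomain_apply_image`).
[folklore] -/
theorem exists_transport {n a : ℕ} (A B : Finset (Fin n)) (eA : Fin a ≃ {x // x ∈ A})
    (eB : Fin a ≃ {x // x ∈ B}) (π₀ : Equiv.Perm (Fin n)) (hπ₀ : ∀ j, j ∈ B ↔ π₀ j ∈ A) :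
    ∃ Φ : Equiv.Perm (Fin a) → Equiv.Perm (Fin n),
      (∀ σ j, j ∉ B → Φ σ j = π₀ j) ∧ (∀ σ y, Φ σ ((eB y : Fin n)) = (eA (σ y) : Fin n)) := by
  set θ : {j // j ∈ B} ≃ {i // i ∈ A} := π₀.subtypeEquiv hπ₀ with hθ
  set τ : Equiv.Perm (Fin a) := eA.trans (θ.symm.trans eB.symm) with hτ
  refine ⟨fun σ => π₀ * Equiv.Perm.extendDomain (σ.trans τ) eB, fun σ j hj => ?_, fun σ y => ?_⟩
  · rw [Equiv.Perm.mul_apply, Equiv.Perm.extendDomain_apply_not_subtype _ _ hj]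
  · rw [Equiv.Perm.mul_apply, Equiv.Perm.extendDomain_apply_image]
    simp [hτ, hθ]

/-- **stub_blockCountOfFactor — frozen extensions of a block with an `f`-factor are many.**
For a block `A × B` (`#A = #B = a`), a frozen matching `π₀` with `π₀ (B) = A`
(`j ∈ B ↔ π₀ j ∈ A`), a graph `Yb ⊆ A ×ˢ B` and an `f`-regular `Y' ⊆ Yb` (`f ≥ 1`, every row
of `A` and every column of `B` has exactly `f` cells of `Y'`), the permutations `π` with
`π j = π₀ j` off `B` and `(π j, j) ∈ Yb` on `B` number at least `f ^ a · a! / a ^ a`: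
`f ^ a · a! ≤ a ^ a · #P`.  Transport `Y'` to an `f`-regular graph `Ys` on the `a`-board
(`card_filter_univ_eq_card_filter`), apply the counting consequence
`DensePerHardReg.pow_mul_factorial_le_of_vdW` of the van der Waerden permanent bound
(discharged: `VanDerWaerdenPermanent_holds`) to get `f ^ a · a! ≤ a ^ a · #PM(Ys)`, and inject
`PM(Ys) ↪ P` by `σ ↦ π₀ * (σ ⬝ τ).extendDomain eB` (`exists_transport`,
`Finset.card_le_card_of_injOn`). [cite: Egorychev1981, Theorem 1 (p. 300)] -/
theorem stub_blockCountOfFactor :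
    ∀ (n a f : ℕ) (A B : Finset (Fin n)) (Yb Y' : Finset (Fin n × Fin n)) (π₀ : Equiv.Perm (Fin n)),
      A.card = a → B.card = a → (∀ j, j ∈ B ↔ π₀ j ∈ A) → Y' ⊆ Yb → Yb ⊆ A ×ˢ B → 1 ≤ f →
      (∀ i ∈ A, (B.filter fun j => (i, j) ∈ Y').card = f) →
      (∀ j ∈ B, (A.filter fun i => (i, j) ∈ Y').card = f) →
      f ^ a * a.factorial ≤ a ^ a *
        ((Finset.univ : Finset (Equiv.Perm (Fin n))).filter fun π : Equiv.Perm (Fin n) =>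
          (∀ j, j ∉ B → π j = π₀ j) ∧ (∀ j ∈ B, (π j, j) ∈ Yb)).card := by
  intro n a f A B Yb Y' π₀ hA hB hπ₀ hY' _ hf hrow hcol
  classical
  -- (1) the small board
  set eA : Fin a ≃ {x // x ∈ A} := (A.orderIsoOfFin hA).toEquiv with heA
  set eB : Fin a ≃ {x // x ∈ B} := (B.orderIsoOfFin hB).toEquiv with heB
  set Ys : Finset (Fin a × Fin a) :=
    univ.filter (fun xy : Fin a × Fin a => ((eA xy.1 : Fin n), (eB xy.2 : Fin n)) ∈ Y') with hYs
  have hmemYs : ∀ x y, (x, y) ∈ Ys ↔ ((eA x : Fin n), (eB y : Fin n)) ∈ Y' := fun x y => by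
    simp [hYs]
  have hrowS : ∀ x : Fin a, (univ.filter fun y : Fin a => (x, y) ∈ Ys).card = f := fun x =>
    (card_filter_univ_eq_card_filter B eB (fun j => ((eA x : Fin n), j) ∈ Y') _
      (fun y => hmemYs x y)).trans (hrow _ (eA x).2)
  have hcolS : ∀ y : Fin a, (univ.filter fun x : Fin a => (x, y) ∈ Ys).card = f := fun y =>
    (card_filter_univ_eq_card_filter A eA (fun i => (i, (eB y : Fin n)) ∈ Y') _
      (fun x => hmemYs x y)).trans (hcol _ (eB y).2)
  -- (2) van der Waerden on the small board
  have hvdW := DensePerHardReg.pow_mul_factorial_le_of_vdW VanDerWaerdenPermanent_holds Ys hf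
    hrowS hcolS
  refine hvdW.trans (Nat.mul_le_mul_left _ ?_)
  -- (3) the injection `PM(Ys) ↪ P`
  obtain ⟨Φ, hΦoff, hΦon⟩ := exists_transport A B eA eB π₀ hπ₀
  refine Finset.card_le_card_of_injOn Φ (fun σ hσ => ?_) (fun σ₁ _ σ₂ _ h => ?_)
  · have hσ' : ∀ y, (σ y, y) ∈ Ys := (Finset.mem_filter.1 (Finset.mem_coe.1 hσ)).2
    refine Finset.mem_coe.2 (Finset.mem_filter.2
      ⟨Finset.mem_univ _, fun j hj => hΦoff σ j hj, fun j hj => ?_⟩)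
    obtain ⟨y, rfl⟩ : ∃ y, (eB y : Fin n) = j := ⟨eB.symm ⟨j, hj⟩, by simp⟩
    rw [hΦon]
    exact hY' ((hmemYs _ _).1 (hσ' y))
  · refine Equiv.ext fun y => eA.injective (Subtype.ext ?_)
    rw [← hΦon σ₁ y, ← hΦon σ₂ y, h]

end Summit.ValiantsHypothesis.ValiantsHypothesis.Theorems.DivisionGap.PerMultiplesHard.BlockCountOfFactor

end
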